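import Mathlib
import HarnessLib
import Summits.ValiantsHypothesis.ValiantsHypothesis.Theorems.LacunarySymmetroidMatrixDescartesProductPlusOneMixedCalculus

/-!
# ValiantsHypothesis / LacunarySymmetroid — crux `MatrixDescartes` (stmt-ValiantsHypothesis-18050, V1),
# LINE (A) «product_plus_one», research stub `stub_classRowK3`: the MIXED SECTOR (ratio `2 ≤ q/p ≤ 4`) is LINEAR in `m`

`mixed_sector_pos_roots`: trinomials `g_j = a_j + b_j X^{e+1} + c_j X^{e+k+2}` on a common support with `e ≤ k ≤ 3e + 2` (support ratio
`(e+k+2)/(e+1) ∈ [2, 4]`), EACH factor either NO-DIP (`a_j c_j < 0`) or a SHARP DIP (`a_j, c_j > 0`, negative somewhere): for every `κ`,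
`Z₊(κ + ∏_j g_j) ≤ 4m + 2`.  Both factor types have a strictly decreasing normalised logarithmic derivative in the power chart
(`numerator_neg` of `…TameCalculus` for no-dip, `dip_numerator_neg` of `…MixedCalculus` for sharp dips), so the two landed sectors
(`…TameSector`, `…SharpSector`) GLUE in this ratio window: members MIXING the two factor types are linear too.  `mixed_sector_class`:
the line's member shape with `d 0 < d 1 < d 2`, `2(d 1 − d 0) ≤ d 2 − d 0 ≤ 4(d 1 − d 0)`, bottom coupling `l₀ = 0`.

HONEST FRAMING: a SECTOR of the `K = 3` row (every factor vanishes on `(0,∞)`, ratio in `[2,4]`, bottom coupling — top coupling is the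
`x ↦ 1/x` mirror of `…TameReverse`); zero-free factors, ratio outside `[2,4]` for mixed members, and the middle coupling stay OPEN, as do
`stub_classRowK3`, `stub_polyLaw`, `ProductPlusOneMDR`, `MatrixDescartes`, Conjecture B; `VP ≠ VNP` is NOT proved.  No definitions, no
named facts; Mathlib + the lane files.
-/

-- `Summit.ValiantsHypothesis.ValiantsHypothesis.…` is the tree's mandated single-conjunct layout (Sub = Summit).
set_option linter.dupNamespace false

namespace Summit.ValiantsHypothesis.ValiantsHypothesis.Theorems.LacunarySymmetroidMatrixDescartes

namespace ProductPlusOne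

open Polynomial Finset
open scoped BigOperators

/-! ### `Ψ′ < 0` for mixed factor types -/

/-- **`Ψ′ < 0`** on the mixed sector: at every `x > 0` where no factor vanishes, `Ψ = Σ_j T_j` has a NEGATIVE derivative (`m ≥ 1`).
[this file's theorem] -/
theorem hasDerivAt_psi_neg_mixed {m : ℕ} (hm : 0 < m) (a b c : Fin m → ℝ) (e k : ℕ) (hke : e ≤ k) (hk : k ≤ 3 * e + 2)
    (hfac : ∀ j, a j * c j < 0 ∨ (0 < a j ∧ 0 < c j ∧ ∃ x₀ : ℝ, 0 < x₀ ∧ a j + b j * x₀ ^ (e + 1) + c j * x₀ ^ (e + k + 2) < 0))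
    {x : ℝ} (hx : 0 < x) (hg : ∀ j, a j + b j * x ^ (e + 1) + c j * x ^ (e + k + 2) ≠ 0) :
    ∃ D : ℝ, D < 0 ∧ HasDerivAt (fun y : ℝ => ∑ j, ((e + 1 : ℝ) * b j + (e + k + 2 : ℝ) * c j * y ^ (k + 1))
        / (a j + b j * y ^ (e + 1) + c j * y ^ (e + k + 2))) D x := by
  refine ⟨∑ j, ((((e + k + 2 : ℝ) * c j * ((k + 1 : ℝ) * x ^ k)) * (a j + b j * x ^ (e + 1) + c j * x ^ (e + k + 2))
        - ((e + 1 : ℝ) * b j + (e + k + 2 : ℝ) * c j * x ^ (k + 1))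
          * (b j * ((e + 1 : ℝ) * x ^ e) + c j * ((e + k + 2 : ℝ) * x ^ (e + k + 1))))
        / (a j + b j * x ^ (e + 1) + c j * x ^ (e + k + 2)) ^ 2), ?_, ?_⟩
  · refine Finset.sum_neg (fun j _ => ?_) ⟨⟨0, hm⟩, Finset.mem_univ _⟩
    refine div_neg_of_neg_of_pos ?_ (by have h0 := hg j; positivity)
    rcases hfac j with hac | ⟨ha, hc, x₀, hx₀, hneg⟩
    · exact numerator_neg (a j) (b j) (c j) e k hk hac hx
    · exact dip_numerator_neg (a j) (b j) (c j) x₀ e k hke ha hc hx₀ hneg hx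
  · exact HasDerivAt.fun_sum (u := Finset.univ) (fun j _ => hasDerivAt_term (a j) (b j) (c j) e k (hg j))

/-- Rolle for `Ψ` on the mixed sector. [this file's lemma] -/
theorem psi_injective_mixed {m : ℕ} (hm : 0 < m) (a b c : Fin m → ℝ) (e k : ℕ) (hke : e ≤ k) (hk : k ≤ 3 * e + 2)
    (hfac : ∀ j, a j * c j < 0 ∨ (0 < a j ∧ 0 < c j ∧ ∃ x₀ : ℝ, 0 < x₀ ∧ a j + b j * x₀ ^ (e + 1) + c j * x₀ ^ (e + k + 2) < 0))
    {w₁ w₂ : ℝ} (hw₁ : 0 < w₁) (hw : w₁ < w₂)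
    (hfree : ∀ t ∈ Set.Icc w₁ w₂, ∀ j, a j + b j * t ^ (e + 1) + c j * t ^ (e + k + 2) ≠ 0)
    (heq : (∑ j, ((e + 1 : ℝ) * b j + (e + k + 2 : ℝ) * c j * w₁ ^ (k + 1)) / (a j + b j * w₁ ^ (e + 1) + c j * w₁ ^ (e + k + 2)))
      = ∑ j, ((e + 1 : ℝ) * b j + (e + k + 2 : ℝ) * c j * w₂ ^ (k + 1)) / (a j + b j * w₂ ^ (e + 1) + c j * w₂ ^ (e + k + 2))) :
    False := by
  have hcont : ContinuousOn (fun y : ℝ => ∑ j, ((e + 1 : ℝ) * b j + (e + k + 2 : ℝ) * c j * y ^ (k + 1))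
      / (a j + b j * y ^ (e + 1) + c j * y ^ (e + k + 2))) (Set.Icc w₁ w₂) := by
    intro t ht
    obtain ⟨D, _, hD⟩ := hasDerivAt_psi_neg_mixed hm a b c e k hke hk hfac (hw₁.trans_le ht.1) (hfree t ht)
    exact hD.continuousAt.continuousWithinAt
  obtain ⟨ξ, hξ, hξ'⟩ := exists_deriv_eq_zero hw hcont heq
  obtain ⟨D, hDneg, hD⟩ := hasDerivAt_psi_neg_mixed hm a b c e k hke hk hfac (hw₁.trans hξ.1)
    (hfree ξ ⟨hξ.1.le, hξ.2.le⟩)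
  rw [hD.deriv] at hξ'
  exact hDneg.ne hξ'

/-! ### Factors and the product -/

/-- Every factor of the mixed sector is a nonzero polynomial. [folklore] -/
theorem prod_trinomial_ne_zero_mixed {m : ℕ} (a b c : Fin m → ℝ) (e k : ℕ)
    (hfac : ∀ j, a j * c j < 0 ∨ (0 < a j ∧ 0 < c j ∧ ∃ x₀ : ℝ, 0 < x₀ ∧ a j + b j * x₀ ^ (e + 1) + c j * x₀ ^ (e + k + 2) < 0)) :
    (∏ j, (C (a j) + C (b j) * X ^ (e + 1) + C (c j) * X ^ (e + k + 2)) : ℝ[X]) ≠ 0 := by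
  refine Finset.prod_ne_zero_iff.mpr (fun j _ => ?_)
  rcases hfac j with hac | ⟨ha, _, _⟩
  · exact trinomial_ne_zero _ _ _ e k hac
  · exact trinomial_ne_zero_of_pos _ _ _ e k ha

/-- **The product has at most `2m` positive zeros** on the mixed sector. [folklore] -/
theorem prod_trinomial_pos_roots_le_mixed {m : ℕ} (a b c : Fin m → ℝ) (e k : ℕ)
    (hfac : ∀ j, a j * c j < 0 ∨ (0 < a j ∧ 0 < c j ∧ ∃ x₀ : ℝ, 0 < x₀ ∧ a j + b j * x₀ ^ (e + 1) + c j * x₀ ^ (e + k + 2) < 0)) :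
    ((∏ j, (C (a j) + C (b j) * X ^ (e + 1) + C (c j) * X ^ (e + k + 2)) : ℝ[X]).roots.toFinset.filter
      (fun t => 0 < t)).card ≤ 2 * m := by
  classical
  have hne : ∀ j, (C (a j) + C (b j) * X ^ (e + 1) + C (c j) * X ^ (e + k + 2) : ℝ[X]) ≠ 0 := by
    intro j
    rcases hfac j with hac | ⟨ha, _, _⟩
    · exact trinomial_ne_zero _ _ _ e k hac
    · exact trinomial_ne_zero_of_pos _ _ _ e k ha
  have hsub : ((∏ j, (C (a j) + C (b j) * X ^ (e + 1) + C (c j) * X ^ (e + k + 2)) : ℝ[X]).roots.toFinset.filter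
      (fun t => 0 < t)) ⊆ Finset.univ.biUnion (fun j =>
        ((C (a j) + C (b j) * X ^ (e + 1) + C (c j) * X ^ (e + k + 2) : ℝ[X]).roots.toFinset.filter (fun t => 0 < t))) := by
    intro x hx
    rw [mem_filter, Multiset.mem_toFinset, mem_roots (prod_trinomial_ne_zero_mixed a b c e k hfac), IsRoot.def,
      eval_prod, Finset.prod_eq_zero_iff] at hx
    obtain ⟨⟨j, _, hj⟩, hx0⟩ := hx
    rw [mem_biUnion]
    refine ⟨j, mem_univ _, ?_⟩
    rw [mem_filter, Multiset.mem_toFinset, mem_roots (hne j), IsRoot.def]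
    exact ⟨hj, hx0⟩
  refine (card_le_card hsub).trans (card_biUnion_le.trans ?_)
  calc ∑ j, (((C (a j) + C (b j) * X ^ (e + 1) + C (c j) * X ^ (e + k + 2) : ℝ[X]).roots.toFinset.filter
          (fun t => 0 < t))).card
      ≤ ∑ _j : Fin m, 2 := Finset.sum_le_sum (fun j _ => by
          rcases hfac j with hac | ⟨ha, hc, _⟩
          · exact (trinomial_pos_roots_le_one _ _ _ e k hac).trans one_le_two
          · exact trinomial_pos_roots_le_two _ _ _ e k ha hc)
    _ = 2 * m := by simp [mul_comm]

/-! ### The count -/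

/-- **THE MIXED SECTOR IS LINEAR**: `Z₊(κ + ∏_j g_j) ≤ 4m + 2` for trinomials on a common support with ratio in `[2,4]`
(`e ≤ k ≤ 3e+2`), every factor no-dip or sharp-dip; every real `κ`, every `m`. [this file's theorem] -/
theorem mixed_sector_pos_roots {m : ℕ} (a b c : Fin m → ℝ) (e k : ℕ) (hke : e ≤ k) (hk : k ≤ 3 * e + 2)
    (hfac : ∀ j, a j * c j < 0 ∨ (0 < a j ∧ 0 < c j ∧ ∃ x₀ : ℝ, 0 < x₀ ∧ a j + b j * x₀ ^ (e + 1) + c j * x₀ ^ (e + k + 2) < 0))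
    (κ : ℝ) :
    ((C κ + ∏ j, (C (a j) + C (b j) * X ^ (e + 1) + C (c j) * X ^ (e + k + 2))).roots.toFinset.filter
      (fun t => 0 < t)).card ≤ 4 * m + 2 := by
  classical
  set P : ℝ[X] := ∏ j, (C (a j) + C (b j) * X ^ (e + 1) + C (c j) * X ^ (e + k + 2)) with hPdef
  rcases Nat.eq_zero_or_pos m with hm | hm
  · subst hm
    have hP1 : P = 1 := by rw [hPdef]; exact Fintype.prod_empty _
    rw [hP1, ← C_1, ← C_add, roots_C, Multiset.toFinset_zero, Finset.filter_empty, Finset.card_empty]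
    exact Nat.zero_le _
  have hP0 : P ≠ 0 := prod_trinomial_ne_zero_mixed a b c e k hfac
  by_cases hκ : κ = 0
  · subst hκ
    rw [map_zero, zero_add]
    exact (prod_trinomial_pos_roots_le_mixed a b c e k hfac).trans (by omega)
  set S := (C κ + P).roots.toFinset.filter (fun t => 0 < t) with hSdef
  set Zp := P.roots.toFinset.filter (fun t => 0 < t) with hZp
  have hZcard : Zp.card ≤ 2 * m := prod_trinomial_pos_roots_le_mixed a b c e k hfac
  -- members of `S` are positive zeros of `κ + P`, and `P` does not vanish at them
  have hSmem : ∀ z ∈ S, 0 < z ∧ eval z (C κ + P) = 0 := by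
    intro z hz
    rw [hSdef, mem_filter, Multiset.mem_toFinset] at hz
    by_cases h0 : C κ + P = 0
    · rw [h0, roots_zero] at hz
      exact absurd hz.1 (Multiset.notMem_zero _)
    · exact ⟨hz.2, (IsRoot.def).mp ((mem_roots h0).mp hz.1)⟩
  have hPne : ∀ z ∈ S, eval z P ≠ 0 := by
    intro z hz hPz
    have h := (hSmem z hz).2
    rw [eval_add, eval_C, hPz, add_zero] at h
    exact hκ h
  -- two members with the same number of zeros of `P` below them span a zero-free interval
  have hfree : ∀ z₁ ∈ S, ∀ z₃ ∈ S, z₁ < z₃ →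
      (Zp.filter (fun t => t < z₁)).card = (Zp.filter (fun t => t < z₃)).card →
      ∀ t ∈ Set.Icc z₁ z₃, ∀ j, a j + b j * t ^ (e + 1) + c j * t ^ (e + k + 2) ≠ 0 := by
    intro z₁ hz₁ z₃ hz₃ h13 hk13 t ht j hj
    have ht0 : 0 < t := (hSmem z₁ hz₁).1.trans_le ht.1
    have hPt : eval t P = 0 := by
      rw [hPdef, eval_prod, Finset.prod_eq_zero_iff]
      exact ⟨j, mem_univ _, by rw [eval_trinomial]; exact hj⟩
    rcases eq_or_lt_of_le ht.2 with h | h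
    · exact hPne z₃ hz₃ (h ▸ hPt)
    · have htZ : t ∈ Zp := by
        rw [hZp, mem_filter, Multiset.mem_toFinset, mem_roots hP0]
        exact ⟨hPt, ht0⟩
      have hsub : Zp.filter (fun s => s < z₁) ⊆ Zp.filter (fun s => s < z₃) := by
        intro s hs
        rw [mem_filter] at hs ⊢
        exact ⟨hs.1, hs.2.trans h13⟩
      have hstrict : Zp.filter (fun s => s < z₁) ⊂ Zp.filter (fun s => s < z₃) := by
        refine Finset.ssubset_iff_subset_ne.mpr ⟨hsub, fun heq => ?_⟩
        have ht1 : t ∈ Zp.filter (fun s => s < z₁) := by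
          rw [heq, mem_filter]
          exact ⟨htZ, h⟩
        rw [mem_filter] at ht1
        exact absurd ht1.2 (not_lt.mpr ht.1)
      exact absurd hk13 (Finset.card_lt_card hstrict).ne
  -- a zero of `P′` in a zero-free region is a zero of `Ψ`
  have hΨzero : ∀ w : ℝ, 0 < w → (∀ j, a j + b j * w ^ (e + 1) + c j * w ^ (e + k + 2) ≠ 0) →
      eval w (derivative P) = 0 →
      (∑ j, ((e + 1 : ℝ) * b j + (e + k + 2 : ℝ) * c j * w ^ (k + 1))
          / (a j + b j * w ^ (e + 1) + c j * w ^ (e + k + 2))) = 0 := by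
    intro w hw hg hd
    rw [hPdef, eval_derivative_prod a b c e k hg] at hd
    rcases mul_eq_zero.mp hd with h | h
    · rcases mul_eq_zero.mp h with h' | h'
      · exact absurd h' (Finset.prod_ne_zero_iff.mpr (fun j _ => hg j))
      · exact absurd h' (pow_ne_zero _ hw.ne')
    · exact h
  -- every fibre of `z ↦ #{zeros of P below z}` on `S` has at most two elements
  have hfiber : ∀ v ∈ S.image (fun z => (Zp.filter (fun t => t < z)).card),
      (S.filter (fun z => (Zp.filter (fun t => t < z)).card = v)).card ≤ 2 := by
    intro v _
    by_contra hcon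
    push Not at hcon
    set F := S.filter (fun z => (Zp.filter (fun t => t < z)).card = v) with hF
    have hFS : ∀ z ∈ F, z ∈ S ∧ (Zp.filter (fun t => t < z)).card = v := by
      intro z hz
      rw [hF, mem_filter] at hz
      exact hz
    have hne : F.Nonempty := Finset.card_pos.mp (by omega)
    have hz₁F : F.min' hne ∈ F := Finset.min'_mem F hne
    have hF₁card : 2 ≤ (F.erase (F.min' hne)).card := by
      rw [Finset.card_erase_of_mem hz₁F]
      omega
    have hne₁ : (F.erase (F.min' hne)).Nonempty := Finset.card_pos.mp (by omega)
    have hz₂F₁ : (F.erase (F.min' hne)).min' hne₁ ∈ F.erase (F.min' hne) := Finset.min'_mem _ hne₁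
    have hne₂ : ((F.erase (F.min' hne)).erase ((F.erase (F.min' hne)).min' hne₁)).Nonempty :=
      Finset.card_pos.mp (by rw [Finset.card_erase_of_mem hz₂F₁]; omega)
    obtain ⟨z₃, hz₃F₂⟩ := hne₂
    set z₁ := F.min' hne with hz₁
    set z₂ := (F.erase z₁).min' hne₁ with hz₂
    have hz₂F : z₂ ∈ F := Finset.mem_of_mem_erase hz₂F₁
    have hz₃F₁ : z₃ ∈ F.erase z₁ := Finset.mem_of_mem_erase hz₃F₂
    have hz₃F : z₃ ∈ F := Finset.mem_of_mem_erase hz₃F₁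
    have h12 : z₁ < z₂ :=
      lt_of_le_of_ne (Finset.min'_le F z₂ hz₂F) (Finset.ne_of_mem_erase hz₂F₁).symm
    have h23 : z₂ < z₃ :=
      lt_of_le_of_ne (Finset.min'_le _ z₃ hz₃F₁) (Finset.ne_of_mem_erase hz₃F₂).symm
    obtain ⟨hz₁S, hk₁⟩ := hFS z₁ hz₁F
    obtain ⟨hz₂S, _⟩ := hFS z₂ hz₂F
    obtain ⟨hz₃S, hk₃⟩ := hFS z₃ hz₃F
    have free13 := hfree z₁ hz₁S z₃ hz₃S (h12.trans h23) (hk₁.trans hk₃.symm)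
    obtain ⟨w₁, hw₁, hd₁⟩ := exists_deriv_root_between a b c e k κ h12 (hSmem z₁ hz₁S).2 (hSmem z₂ hz₂S).2
    obtain ⟨w₂, hw₂, hd₂⟩ := exists_deriv_root_between a b c e k κ h23 (hSmem z₂ hz₂S).2 (hSmem z₃ hz₃S).2
    have hw₁pos : 0 < w₁ := (hSmem z₁ hz₁S).1.trans hw₁.1
    have hw₁₂ : w₁ < w₂ := hw₁.2.trans hw₂.1
    have hIcc : Set.Icc w₁ w₂ ⊆ Set.Icc z₁ z₃ :=
      fun t ht => ⟨hw₁.1.le.trans ht.1, ht.2.trans hw₂.2.le⟩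
    have hg₁ := free13 w₁ (hIcc ⟨le_rfl, hw₁₂.le⟩)
    have hg₂ := free13 w₂ (hIcc ⟨hw₁₂.le, le_rfl⟩)
    have hΨ₁ := hΨzero w₁ hw₁pos hg₁ hd₁
    have hΨ₂ := hΨzero w₂ (hw₁pos.trans hw₁₂) hg₂ hd₂
    exact psi_injective_mixed hm a b c e k hke hk hfac hw₁pos hw₁₂ (fun t ht => free13 t (hIcc ht)) (hΨ₁.trans hΨ₂.symm)
  have himg : S.image (fun z => (Zp.filter (fun t => t < z)).card) ⊆ Finset.range (2 * m + 1) := by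
    intro v hv
    rw [Finset.mem_image] at hv
    obtain ⟨z, _, rfl⟩ := hv
    rw [Finset.mem_range]
    exact Nat.lt_succ_of_le ((Finset.card_filter_le _ _).trans hZcard)
  calc S.card = ∑ v ∈ S.image (fun z => (Zp.filter (fun t => t < z)).card),
        (S.filter (fun z => (Zp.filter (fun t => t < z)).card = v)).card :=
        Finset.card_eq_sum_card_image _ S
    _ ≤ ∑ _v ∈ S.image (fun z => (Zp.filter (fun t => t < z)).card), 2 := Finset.sum_le_sum hfiber
    _ = 2 * (S.image (fun z => (Zp.filter (fun t => t < z)).card)).card := by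
        rw [Finset.sum_const, smul_eq_mul, mul_comm]
    _ ≤ 2 * (2 * m + 1) :=
        Nat.mul_le_mul_left 2 ((Finset.card_le_card himg).trans (by rw [Finset.card_range]))
    _ = 4 * m + 2 := by ring


/-- **THE MIXED SECTOR OF THE `K = 3` ROW, line shape** (`C c * X ^ (m * d 0) + ∏ j, fewnomial d (a j)` unfolded, bottom coupling):
supports `d 0 < d 1 < d 2` with `2·(d 1 − d 0) ≤ d 2 − d 0 ≤ 4·(d 1 − d 0)`; every factor either `a j 0 · a j 2 < 0` or
(`a j 0 > 0`, `a j 2 > 0`, negative somewhere on `(0,∞)`) ⇒ at most `4m + 2` positive zeros. [this file's theorem] -/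
theorem mixed_sector_class {m : ℕ} (d : Fin 3 → ℕ) (h01 : d 0 < d 1) (h12 : d 1 < d 2)
    (h2 : 2 * (d 1 - d 0) ≤ d 2 - d 0) (h4 : d 2 - d 0 ≤ 4 * (d 1 - d 0)) (a : Fin m → Fin 3 → ℝ)
    (hfac : ∀ j, a j 0 * a j 2 < 0 ∨
      (0 < a j 0 ∧ 0 < a j 2 ∧ ∃ x₀ : ℝ, 0 < x₀ ∧ a j 0 * x₀ ^ (d 0) + a j 1 * x₀ ^ (d 1) + a j 2 * x₀ ^ (d 2) < 0)) (c : ℝ) :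
    ((C c * X ^ (m * d 0) + ∏ j, ∑ l, C (a j l) * X ^ (d l) : ℝ[X]).roots.toFinset.filter (fun t => 0 < t)).card
      ≤ 4 * m + 2 := by
  classical
  obtain ⟨e, he⟩ : ∃ e, d 1 = d 0 + e + 1 := ⟨d 1 - d 0 - 1, by omega⟩
  obtain ⟨k, hk⟩ : ∃ k, d 2 = d 0 + e + k + 2 := ⟨d 2 - d 1 - 1, by omega⟩
  have hke : e ≤ k := by omega
  have hk3 : k ≤ 3 * e + 2 := by omega
  have hfac' : ∀ j, a j 0 * a j 2 < 0 ∨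
      (0 < a j 0 ∧ 0 < a j 2 ∧ ∃ x₀ : ℝ, 0 < x₀ ∧ a j 0 + a j 1 * x₀ ^ (e + 1) + a j 2 * x₀ ^ (e + k + 2) < 0) := by
    intro j
    rcases hfac j with h | ⟨ha, hc, x₀, hx₀, hneg⟩
    · exact Or.inl h
    · refine Or.inr ⟨ha, hc, x₀, hx₀, ?_⟩
      have hxd : 0 < x₀ ^ (d 0) := pow_pos hx₀ _
      have e1 : a j 0 * x₀ ^ (d 0) + a j 1 * x₀ ^ (d 1) + a j 2 * x₀ ^ (d 2)
          = x₀ ^ (d 0) * (a j 0 + a j 1 * x₀ ^ (e + 1) + a j 2 * x₀ ^ (e + k + 2)) := by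
        rw [he, hk]; ring
      rw [e1] at hneg
      by_contra hcon
      push Not at hcon
      exact absurd hneg (not_lt.mpr (mul_nonneg hxd.le hcon))
  have hfacx : ∀ j, (∑ l, C (a j l) * X ^ (d l) : ℝ[X])
      = X ^ (d 0) * (C (a j 0) + C (a j 1) * X ^ (e + 1) + C (a j 2) * X ^ (e + k + 2)) := by
    intro j
    rw [Fin.sum_univ_three, he, hk]
    ring
  have hmem : (C c * X ^ (m * d 0) + ∏ j, ∑ l, C (a j l) * X ^ (d l) : ℝ[X])
      = X ^ (m * d 0) * (C c + ∏ j, (C (a j 0) + C (a j 1) * X ^ (e + 1) + C (a j 2) * X ^ (e + k + 2))) := by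
    rw [Finset.prod_congr rfl (fun j _ => hfacx j), Finset.prod_mul_distrib, Finset.prod_const, Finset.card_univ,
      Fintype.card_fin, ← pow_mul, mul_comm (d 0) m]
    ring
  rw [hmem]
  by_cases h0 : (X ^ (m * d 0) * (C c + ∏ j, (C (a j 0) + C (a j 1) * X ^ (e + 1) + C (a j 2) * X ^ (e + k + 2)))
      : ℝ[X]) = 0
  · rw [h0, roots_zero, Multiset.toFinset_zero, Finset.filter_empty, Finset.card_empty]
    exact Nat.zero_le _
  · rw [roots_mul h0, roots_pow, roots_X, Multiset.toFinset_add, Finset.filter_union]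
    refine (Finset.card_union_le _ _).trans ?_
    have hz : (((m * d 0) • ({0} : Multiset ℝ)).toFinset.filter (fun t => 0 < t)) = ∅ := by
      rw [Finset.filter_eq_empty_iff]
      intro t ht
      rw [Multiset.mem_toFinset] at ht
      have h00 := Multiset.mem_singleton.mp (Multiset.mem_of_mem_nsmul ht)
      rw [h00]
      exact lt_irrefl 0
    rw [hz, Finset.card_empty, zero_add]
    exact mixed_sector_pos_roots (fun j => a j 0) (fun j => a j 1) (fun j => a j 2) e k hke hk3 hfac' c

end ProductPlusOne

end Summit.ValiantsHypothesis.ValiantsHypothesis.Theorems.LacunarySymmetroidMatrixDescartes
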